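import Literature.NumberTheory.EllipticCurves.FormalLogExpBaseChangeProofs
import Literature.NumberTheory.GaloisRepresentations.LubinTateLogarithm
import Literature.NumberTheory.GaloisRepresentations.LubinTateTorsion
import Mathlib.NumberTheory.Padics.PadicIntegers
import HarnessLib

/-!
# The curve's formal logarithm IS the Lubin–Tate logarithm through the Lubin–Tate isomorphism:
# `log_W ∘ [1]_{[π],f} = λ_f` and `log_W ∘ ([1]_{[π],f} ∘ [a]_f) = a·λ_f` (de Shalit II §4.9 «`λ_Ê` normalised by `λ_Ê′(0) = 1`»;
# Lubin–Tate 1965 Thm. 1 (9)) — the logarithm-compatibility input of the moment identification, at a place of degree one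

Topic `NumberTheory/EllipticCurves` (theorems only; no definition, no named fact, no instance).  Companion of
`OrdinaryFormalGroupLubinTateModule.lean` (`formalLog_subst_map_hom`: over `ℤ_p`, `log_W ∘ [a]_{[π]} = a·log_W`) and of
`FormalGroupLubinTateDivisionPointsDegreeOne.lean` (the Lubin–Tate ISOMORPHISM
`[1]_{P′,f} = LubinTate.hom (isLTRing_LTCoeff hπ) hP′ (isLTSeries_LTCoeff π) 1 : F_f → V̂`, `f = πX + X^q`, of the measure lane
at a place of degree one), written for the consumer `LubinTateColemanRelativeMomentLogCoordinateTwo.lean` (cell `bsd-print-cf2`,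
piece MI: its hypothesis `hcompat : Λ ∘ (H₁ ∘ H₂) = b·λ_f`).

De Shalit II §4.9 (p. 62–63): "`Q(T) = P(λ_Ê(T))` where `λ_Ê` is the logarithm map of `Ê`, normalized to satisfy `λ_Ê′(0) = 1`
[…] since the formal group law in the `z` variable is the additive law, `z` is […] the normalized logarithm of `t`".  In the lane
the curve's parameter `T` and the Lubin–Tate parameter `X` of `f = πX + X^q` differ by the isomorphism `[1]_{P′,f}` (and by the
Tate-module unit `[a]_f`); this file proves that the normalised logarithms match through them (0 sorry):

* §1 (any commutative `ℚ`-algebra `B`, `φ : ℚ_p → B`): `formalLog_subst_map_eq_C_mul_of_map_eq_formalExp_subst` — if an integral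
  series `P ∈ ℤ_p⟦X⟧` lifts `[c] = exp_W(c·log_W)` (`P.map = exp_W.subst (C c * log_W)`, the currency of
  `OrdinaryFormalGroupLubinTate.exists_isLTSeries_formalGroupLaw_eq_ltF` / `X049….cm7Padic_exists_formalGroupLaw_eq_ltF`), then
  read in `B`: **`log_{W^φ} ∘ P^φ = φ(c) · log_{W^φ}`**;
* §2 (`F` a non-archimedean local field of characteristic zero, `π` a uniformiser, ANY `P′ ∈ 𝔉_π` over `LTCoeff F` and ANY
  Weierstrass equation `W/F` whose formal logarithm linearises `P′`: `hlog : log_W ∘ P′ = π·log_W`):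
  ★★ `formalLog_subst_map_hom_one_eq_ltLog` — **`log_W ∘ [1]_{P′,f} = λ_f`** (uniqueness of the Lubin–Tate logarithm `eq_ltLog`:
  `log_W ∘ [1] ≡ X`, and `(log_W ∘ [1]) ∘ f = log_W ∘ P′ ∘ [1] = π · log_W ∘ [1]` by `LubinTate.subst_hom`);
  ★★ `formalLog_subst_map_hom_one_subst_hom_eq` — **`log_W ∘ ([1]_{P′,f} ∘ [a]_f) = a · λ_f`** (`subst_hom_ltLog`);
  ★★★ `formalLog_map_subst_map_subst_hom_eq` — the same read in any `F`-algebra `B` through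
  `τ_B : LTCoeff F → 𝒪_F → F → B`: **`log_{W^B} ∘ ((PowerSeries.subst [a]_f [1]_{P′,f})^{τ_B}) = C (τ_B a) · λ_f^B`** —
  LITERALLY the hypothesis `hcompat` of `map_constantCoeff_iterate_relDerivation_relLogDerivSeries_of_eq_subst_subst` with
  `Λ := log_{W^B}`, `H₁ := [1]_{P′,f}`, `H₂ := [a]_f`, `b := τ_B a` (so `e_Λ = exp_{W^B}`).

## References
* [deShalit1987] E. de Shalit, *Iwasawa theory of elliptic curves with complex multiplication* (1987), I §1.2, II §1.10, II §4.9.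
* [LubinTate1965] J. Lubin, J. Tate, *Formal complex multiplication in local fields*, Ann. of Math. 81 (1965), §1 Lemma 1, Thm. 1 (9).
* [SilvermanAEC2009] J. H. Silverman, *The Arithmetic of Elliptic Curves*, 2nd ed. (2009), IV.5.5–5.6.
-/

noncomputable section

open PowerSeries

namespace Literature.NumberTheory.EllipticCurves

/-! ## §1 `log_W` linearises an integral lift of `[c] = exp_W(c·log_W)`, read in any `ℚ`-algebra -/

section RatTransport

variable {p : ℕ} [Fact p.Prime] {B : Type*} [CommRing B] [Algebra ℚ B]

/-- **`log_{W^φ} ∘ P^φ = φ(c)·log_{W^φ}`** for an integral lift `P ∈ ℤ_p⟦X⟧` of `[c] = exp_W(c·log_W)` (`W = V ⊗ ℚ_p`), read in a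
`ℚ`-algebra `B` through `φ : ℚ_p → B` (`log`, `exp` commute with base change; `log_W(exp_W(c·log_W z)) = c·log_W z`).
[cite: SilvermanAEC2009, IV.5.6] [cite: deShalit1987, Ch. I §1.2] -/
theorem formalLog_subst_map_eq_C_mul_of_map_eq_formalExp_subst (V : WeierstrassCurve ℤ_[p]) {c : ℤ_[p]} {P : ℤ_[p]⟦X⟧}
    (hP : P.map PadicInt.Coe.ringHom =
      (V.map PadicInt.Coe.ringHom).formalExp.subst (C (c : ℚ_[p]) * (V.map PadicInt.Coe.ringHom).formalLog))
    (φ : ℚ_[p] →+* B) :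
    (V.map (φ.comp PadicInt.Coe.ringHom)).formalLog.subst (P.map (φ.comp PadicInt.Coe.ringHom)) =
      C (φ c) * (V.map (φ.comp PadicInt.Coe.ringHom)).formalLog := by
  set W : WeierstrassCurve ℚ_[p] := V.map PadicInt.Coe.ringHom with hW
  have hVB : V.map (φ.comp PadicInt.Coe.ringHom) = W.map φ := by rw [hW, WeierstrassCurve.map_map]
  have hcl0 : constantCoeff (C (c : ℚ_[p]) * W.formalLog) = 0 := by
    rw [map_mul, W.constantCoeff_formalLog, mul_zero]
  have hPB : P.map (φ.comp PadicInt.Coe.ringHom) = (W.map φ).formalExp.subst (C (φ c) * (W.map φ).formalLog) := by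
    rw [PowerSeries.map_comp, RingHom.comp_apply, hP, Literature.NumberTheory.GaloisRepresentations.map_subst₁F φ hcl0,
      W.map_formalExp φ, map_mul, map_C, W.map_formalLog φ]
  have hclB : constantCoeff (C (φ c) * (W.map φ).formalLog) = 0 := by
    rw [map_mul, (W.map φ).constantCoeff_formalLog, mul_zero]
  rw [hVB, hPB, ← subst_comp_subst_apply (HasSubst.of_constantCoeff_zero' (W.map φ).constantCoeff_formalExp)
    (HasSubst.of_constantCoeff_zero' hclB), (W.map φ).formalLog_subst_formalExp, subst_X (HasSubst.of_constantCoeff_zero' hclB)]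

end RatTransport

/-! ## §2 `log_W ∘ [1]_{P′,f} = λ_f` over a local field of characteristic zero -/

section LubinTateLog

open ValuativeRel IsLocalRing Field Literature.NumberTheory.GaloisRepresentations
  Literature.NumberTheory.GaloisRepresentations.IsNonarchimedeanLocalField Literature.NumberTheory.GaloisRepresentations.LubinTate

variable {F : Type} [Field F] [ValuativeRel F] [TopologicalSpace F] [IsNonarchimedeanLocalField F] [CharZero F]
variable {π : 𝒪[F]} (hπ : (valuation F).IsUniformizer (π : F))
  {P' : PowerSeries (LTCoeff F)} (hP' : IsLTSeries (LTCoeff.of F π) (residueFieldCard F) P')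
  (W : WeierstrassCurve F)
  (hlog : W.formalLog.subst (P'.map ((algebraMap 𝒪[F] F).comp (LTCoeff.of F).symm.toRingHom)) =
    C ((π : 𝒪[F]) : F) * W.formalLog)

omit [TopologicalSpace F] [IsNonarchimedeanLocalField F] [CharZero F] in
/-- Linear coefficient of a composition `Λ ∘ H` with `H(0) = 0`: `[X](Λ ∘ H) = [X]Λ · [X]H`. [folklore] -/
private theorem coeff_one_subst_of_constantCoeff_eq_zero {A : Type*} [CommRing A] {H : A⟦X⟧} (hH : constantCoeff H = 0)
    (Λ : A⟦X⟧) : coeff 1 (Λ.subst H) = coeff 1 Λ * coeff 1 H := by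
  have h := coeff_single_subst (F := Λ) (b := fun _ : Unit => H) (fun _ => hH) ()
  rw [Fintype.sum_unique] at h
  exact h

omit [CharZero F] in
/-- `f = πX + X^q` over `LTCoeff F` read in `F` is `ltPolyF` (unfolding). [folklore] -/
private theorem map_ltSer_eq_ltPolyF' :
    PowerSeries.map ((algebraMap 𝒪[F] F).comp (LTCoeff.of F).symm.toRingHom)
        ((((ltPoly F π : Polynomial 𝒪[F]) : PowerSeries 𝒪[F]) : PowerSeries (LTCoeff F))) = ltPolyF F π := by
  ext n
  rw [coeff_map, ltPolyF, coeff_map]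
  rfl

include hlog in
/-- ★★ **`log_W ∘ [1]_{P′,f} = λ_f`**: if the formal logarithm of `W/F` linearises the Lubin–Tate series `P′ ∈ 𝔉_π`
(`log_W ∘ P′ = π·log_W` — e.g. `P′` an integral lift of `[π] = exp_W(π·log_W)`, §1), then composing it with the Lubin–Tate
isomorphism `[1]_{P′,f} : F_f → F_{P′} = Ŵ` (`f = πX + X^q`) gives THE logarithm `λ_f` of `F_f` — both are `≡ X` and satisfy
`Λ ∘ f = π·Λ` (`P′ ∘ [1] = [1] ∘ f`), so `eq_ltLog` applies.  De Shalit's «`λ_Ê` normalized to `λ_Ê′(0) = 1`».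
[cite: deShalit1987, Ch. I §1.2, Ch. II §4.9] [cite: LubinTate1965, §1 Lemma 1, Thm. 1 (9)] -/
theorem formalLog_subst_map_hom_one_eq_ltLog :
    W.formalLog.subst ((hom (isLTRing_LTCoeff hπ) hP' (isLTSeries_LTCoeff π) 1).map
        ((algebraMap 𝒪[F] F).comp (LTCoeff.of F).symm.toRingHom)) = ltLog hπ := by
  set τ : LTCoeff F →+* F := (algebraMap 𝒪[F] F).comp (LTCoeff.of F).symm.toRingHom with hτ
  set H₁ : PowerSeries (LTCoeff F) := hom (isLTRing_LTCoeff hπ) hP' (isLTSeries_LTCoeff π) 1 with hH₁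
  have hH₁0 : constantCoeff H₁ = 0 := constantCoeff_hom _ _ _ _
  have hH₁F0 : constantCoeff (H₁.map τ) = 0 := by
    rw [← coeff_zero_eq_constantCoeff_apply, coeff_map, coeff_zero_eq_constantCoeff_apply, hH₁0, map_zero]
  have hsH : HasSubst (H₁.map τ) := HasSubst.of_constantCoeff_zero' hH₁F0
  have hP'F0 : constantCoeff (P'.map τ) = 0 := by
    rw [← coeff_zero_eq_constantCoeff_apply, coeff_map, coeff_zero_eq_constantCoeff_apply, hP'.constantCoeff_eq_zero, map_zero]
  have hsP : HasSubst (P'.map τ) := HasSubst.of_constantCoeff_zero' hP'F0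
  have hsf : HasSubst (ltPolyF F π) := HasSubst.of_constantCoeff_zero' (isLTSeries_ltPolyF (π := π)).constantCoeff_eq_zero
  refine eq_ltLog hπ ?_ ?_ ?_
  · exact constantCoeff_subst_eq_zero hH₁F0 _ W.constantCoeff_formalLog
  · rw [coeff_one_subst_of_constantCoeff_eq_zero hH₁F0, W.coeff_one_formalLog, one_mul, coeff_map, hH₁, coeff_one_hom,
      map_one]
  · -- `(log_W ∘ [1]) ∘ f = log_W ∘ ([1] ∘ f) = log_W ∘ (P′ ∘ [1]) = (log_W ∘ P′) ∘ [1] = π · log_W ∘ [1]`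
    have hint : PowerSeries.subst (ltPolyF F π) (H₁.map τ) = PowerSeries.subst (H₁.map τ) (P'.map τ) := by
      have h := congrArg (PowerSeries.map τ) (subst_hom (isLTRing_LTCoeff hπ) hP' (isLTSeries_LTCoeff π) 1)
      rw [map_subst₁F τ hH₁0, map_subst₁F τ (isLTSeries_LTCoeff π).constantCoeff_eq_zero, map_ltSer_eq_ltPolyF'] at h
      rw [← hH₁] at h
      exact h.symm
    rw [subst_comp_subst_apply hsH hsf, hint, ← subst_comp_subst_apply hsP hsH, hlog, ← coe_substAlgHom hsH, map_mul,
      coe_substAlgHom, subst_C]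
    rfl

include hlog in
/-- ★★ **`log_W ∘ ([1]_{P′,f} ∘ [a]_f) = a·λ_f`** (`[a]_f` the Lubin–Tate endomorphism of `f = πX + X^q` over `LTCoeff F`,
`λ_f ∘ [a]_f = a·λ_f`): the change of variable `X ↦ [1]_{P′,f}([a]_f X)` from the Lubin–Tate parameter to the curve's parameter
— the one through which the relative Coleman series of an elliptic unit is the theta `t`-expansion — multiplies logarithms by `a`.
[cite: deShalit1987, Ch. I §1.2, Ch. II §4.9] [cite: LubinTate1965, §1 Thm. 1 (9)] -/
theorem formalLog_subst_map_hom_one_subst_hom_eq (a : LTCoeff F) :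
    W.formalLog.subst (PowerSeries.map ((algebraMap 𝒪[F] F).comp (LTCoeff.of F).symm.toRingHom)
        (PowerSeries.subst (hom (isLTRing_LTCoeff hπ) (isLTSeries_LTCoeff π) (isLTSeries_LTCoeff π) a)
          (hom (isLTRing_LTCoeff hπ) hP' (isLTSeries_LTCoeff π) 1))) =
      C (((LTCoeff.of F).symm a : 𝒪[F]) : F) * ltLog hπ := by
  set τ : LTCoeff F →+* F := (algebraMap 𝒪[F] F).comp (LTCoeff.of F).symm.toRingHom with hτ
  have ha0 : constantCoeff (hom (isLTRing_LTCoeff hπ) (isLTSeries_LTCoeff π) (isLTSeries_LTCoeff π) a) = 0 :=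
    constantCoeff_hom _ _ _ _
  have haF0 : constantCoeff ((hom (isLTRing_LTCoeff hπ) (isLTSeries_LTCoeff π) (isLTSeries_LTCoeff π) a).map τ) = 0 := by
    rw [← coeff_zero_eq_constantCoeff_apply, coeff_map, coeff_zero_eq_constantCoeff_apply, ha0, map_zero]
  have h10 : constantCoeff ((hom (isLTRing_LTCoeff hπ) hP' (isLTSeries_LTCoeff π) 1).map τ) = 0 := by
    rw [← coeff_zero_eq_constantCoeff_apply, coeff_map, coeff_zero_eq_constantCoeff_apply, constantCoeff_hom, map_zero]
  rw [map_subst₁F τ ha0, ← subst_comp_subst_apply (HasSubst.of_constantCoeff_zero' h10) (HasSubst.of_constantCoeff_zero' haF0),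
    formalLog_subst_map_hom_one_eq_ltLog hπ hP' W hlog]
  -- `λ_f ∘ [a]_f = a·λ_f` (`subst_hom_ltLog`, the lane's datum being `isLTRing_integer` / `isLTSeries_ltPoly` verbatim)
  exact subst_hom_ltLog hπ ((LTCoeff.of F).symm a)

include hlog in
/-- ★★★ **The logarithm-compatibility hypothesis of the moment identification, discharged** — read in any `F`-algebra `B`
(a `ℚ`-algebra) through `τ_B : LTCoeff F → 𝒪_F → F → B`:
`log_{W^B} ∘ (PowerSeries.subst [a]_f [1]_{P′,f})^{τ_B} = C (τ_B a) · λ_f^B` — LITERALLY the `hcompat` of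
`map_constantCoeff_iterate_relDerivation_relLogDerivSeries_of_eq_subst_subst` (`LubinTateColemanRelativeMomentLogCoordinateTwo`)
with `Λ := (W.map (algebraMap F B)).formalLog` (so `e_Λ = exp_{W^B}`), `H₁ := [1]_{P′,f}`, `H₂ := [a]_f`, `b := τ_B a`.
[cite: deShalit1987, Ch. I §1.2, Ch. II §4.9] [cite: LubinTate1965, §1 Thm. 1 (9)] -/
theorem formalLog_map_subst_map_subst_hom_eq {B : Type*} [CommRing B] [Algebra ℚ B] [Algebra F B] (a : LTCoeff F) :
    (W.map (algebraMap F B)).formalLog.subst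
        (PowerSeries.map ((algebraMap F B).comp ((algebraMap 𝒪[F] F).comp (LTCoeff.of F).symm.toRingHom))
          (PowerSeries.subst (hom (isLTRing_LTCoeff hπ) (isLTSeries_LTCoeff π) (isLTSeries_LTCoeff π) a)
            (hom (isLTRing_LTCoeff hπ) hP' (isLTSeries_LTCoeff π) 1))) =
      C (((algebraMap F B).comp ((algebraMap 𝒪[F] F).comp (LTCoeff.of F).symm.toRingHom)) a) *
        (ltLog hπ).map (algebraMap F B) := by
  have h := congrArg (PowerSeries.map (algebraMap F B)) (formalLog_subst_map_hom_one_subst_hom_eq hπ hP' W hlog a)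
  have h00 : constantCoeff (PowerSeries.subst (hom (isLTRing_LTCoeff hπ) (isLTSeries_LTCoeff π) (isLTSeries_LTCoeff π) a)
      (hom (isLTRing_LTCoeff hπ) hP' (isLTSeries_LTCoeff π) 1)) = 0 :=
    constantCoeff_subst_eq_zero (constantCoeff_hom (isLTRing_LTCoeff hπ) (isLTSeries_LTCoeff π) (isLTSeries_LTCoeff π) a) _
      (constantCoeff_hom (isLTRing_LTCoeff hπ) hP' (isLTSeries_LTCoeff π) 1)
  have h0 : constantCoeff (PowerSeries.map ((algebraMap 𝒪[F] F).comp (LTCoeff.of F).symm.toRingHom)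
      (PowerSeries.subst (hom (isLTRing_LTCoeff hπ) (isLTSeries_LTCoeff π) (isLTSeries_LTCoeff π) a)
        (hom (isLTRing_LTCoeff hπ) hP' (isLTSeries_LTCoeff π) 1))) = 0 := by
    rw [← coeff_zero_eq_constantCoeff_apply, coeff_map, coeff_zero_eq_constantCoeff_apply, h00, map_zero]
  rw [map_subst₁F _ h0, W.map_formalLog, ← RingHom.comp_apply (PowerSeries.map (algebraMap F B))
      (PowerSeries.map ((algebraMap 𝒪[F] F).comp (LTCoeff.of F).symm.toRingHom)), ← PowerSeries.map_comp, map_mul,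
    map_C] at h
  rw [RingHom.comp_apply]
  exact h

end LubinTateLog

end Literature.NumberTheory.EllipticCurves

end
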